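import Mathlib.Algebra.BigOperators.Group.Finset.Basic
import Literature.AlgebraicGeometry.Frobenioids.PerfFactorialWeak
import Literature.AnabelianGeometry.EtaleTheta.RealificationOrder
import Literature.AnabelianGeometry.EtaleTheta.PerfectionPrimes

/-!
# `M^rlf` in coordinates for WEAKLY perf-factorial `M` (source side of [EtTh] Lemma 3.5, repaired form)

Source: S. Mochizuki, *The étale theta function …* [MochizukiEtTh2009], Lemma 3.5, PDF pp. 75–76
(printed 301–302); objects from [FrdI] Def. 2.4 (i) [MochizukiFrdI2008] in the WEAK form adopted by the
abc-iut cell after finding F-L2d2-1 (tree: `Frobenioids/PerfFactorialWeak.lean` — `IsPerfFactorialWeak`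
= (a), (b), (c) of Def. 2.4 (i) + (d_ord) + (d_res); `IsPerfFactorialWeak.realification`,
`.toRealification`, `.Rlf`).

This is the weak-hypothesis twin of `RealificationOrder.lean` (same seat).  What changes:

1. ORDER REFLECTION `M^pf ↪ M^rlf` now rests on (d_ord) (`IsPerfFactorialWeak.dvd_of_factorMap_mul_eq`)
   instead of (d) — unchanged in substance.
2. APPROXIMATION.  The printed step "for every `a ∈ P^rlf`, there exists an `a' ∈ P^pf` such that
   `a' ≥ a`" (p. 75, from Def. 2.4 (i)(d)) is NOT a consequence of the weak notion: for
   `M = {bounded f : ℕ → ℤ≥0}` (weakly perf-factorial) `M^rlf = ∏_ℕ ℝ≥0` contains elements bounded by NO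
   element of `M^pf`.  It is therefore carried as the explicit hypothesis
   `hcof : ∀ x : M^rlf, ∃ b ∈ M^pf, x ≤ b` (COFINALITY of `M^pf` in `M^rlf`; automatic under (d):
   `rlf_cofinal_of_isPerfFactorial`), and the two-sided approximation `a ≤ x ≤ a · b^{1/n}` below an
   upper bound `b` is proved from (d_res) alone, with `b`-RELATIVE simple-function approximants:
   `a := ∏_{v < n} (b|_{S_v})^{1/n}`, `S_v := {𝔮 | v < ⌊n · x_𝔮 / b_𝔮⌋}`, where `b|_S ∈ M^pf` is the
   restriction of `b` to the set of primes `S` ((d_res)) — instead of the absolute per-prime approximants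
   of the perf-factorial case, which (d) assembled.

Results (`RlfCoordWeak.*`, signatures as in `RlfCoord.*` with `IsPerfFactorial ↦ IsPerfFactorialWeak`
and `hcof` added where needed): `exists_coordinates`, `dvd_antisymm`, `toRealification_dvd_iff`,
`exists_gauge`, `dvd_of_forall_root`; `isMonoprime_pfAt` (Def. 2.4 (i)(b) for `M^pf`, weak hypothesis);
`realification_weak_eq` (`h.weak.realification = h.realification`) and `rlf_cofinal_of_isPerfFactorial`.
Proof-only (no definitions). Seat abc-iut-L2-d2 (cell abc-iut, F-L2d2-1 repair chain, node EtTh:Lem3.5).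
HONEST FRAMING: classical monoid algebra; nothing here bears on [IUTchIII] Cor. 3.12.
-/

namespace Literature.AnabelianGeometry.EtaleTheta

namespace RlfCoordWeak

open Literature.AlgebraicGeometry.Frobenioids NNReal Function RealificationCoord

universe u

variable {M : Type u} [CommMonoid M]

/-- [FrdI] Def. 2.4 (i)(b) for `M^pf` from the WEAK hypothesis: every `M^pf_𝔮` is monoprime (only (a)
sharpness and (b) are used, as in `PerfectionPrimes.isMonoprime_pfAt`). [cite: MochizukiFrdI2008, Def. 2.4(i) p.47] -/
theorem isMonoprime_pfAt (hM : IsPerfFactorialWeak M) (𝔮 : Primes (Perfection M)) :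
    IsMonoprime (PfAt M 𝔮) := by
  obtain ⟨𝔭, ⟨e⟩⟩ := PerfectionPrimes.pfAt_mulEquiv hM.isDivisorial.isSharp 𝔮
  exact PerfectionPrimes.isMonoprime_of_mulEquiv e.symm (PerfectionPrimes.isMonoprime_perfection (hM.isMonoprime 𝔭))

/-- The weak and the printed realification have the SAME carrier `{a | Supp(a) ⊆ Supp(b), b ∈ M^pf}`:
for a perf-factorial `M`, `h.weak.realification = h.realification`. [cite: MochizukiFrdI2008, Def. 2.4(i) p.48] -/
theorem realification_weak_eq (h : IsPerfFactorial M) : h.weak.realification = h.realification := rfl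

/-! ### Two arithmetic lemmas for the relative approximants -/

/-- Rounding `X ≤ B` down to a multiple of `B/n` with at most `n` steps: with `k := min n ⌊n X / B⌋`,
`k · B/n ≤ X ≤ k · B/n + B/n`. [folklore] -/
private theorem floor_rel_step {X B : ℝ≥0} (hXB : X ≤ B) (n : ℕ+) :
    ((min (n : ℕ) ⌊(n : ℝ≥0) * X / B⌋₊ : ℕ) : ℝ≥0) * (B / n) ≤ X ∧
      X ≤ ((min (n : ℕ) ⌊(n : ℝ≥0) * X / B⌋₊ : ℕ) : ℝ≥0) * (B / n) + B / n := by
  have hn : (0 : ℝ≥0) < n := by exact_mod_cast n.pos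
  rcases eq_or_ne B 0 with hB | hB
  · subst hB
    have hX : X = 0 := le_antisymm hXB zero_le
    subst hX
    simp
  have hB' : 0 < B := pos_iff_ne_zero.mpr hB
  set k : ℕ := min (n : ℕ) ⌊(n : ℝ≥0) * X / B⌋₊ with hk
  constructor
  · -- `k ≤ n X / B`
    have h1 : (k : ℝ≥0) ≤ (n : ℝ≥0) * X / B :=
      (Nat.cast_le.mpr (min_le_right _ _)).trans (Nat.floor_le zero_le)
    rw [le_div_iff₀ hB'] at h1
    calc (k : ℝ≥0) * (B / n) = (k : ℝ≥0) * B / n := by rw [mul_div_assoc]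
      _ ≤ (n : ℝ≥0) * X / n := by gcongr
      _ = X := by rw [mul_comm, mul_div_assoc, div_self hn.ne', mul_one]
  · rcases lt_or_ge ⌊(n : ℝ≥0) * X / B⌋₊ (n : ℕ) with hlt | hle
    · -- `k = ⌊n X / B⌋` and `n X / B < k + 1`
      have hk' : k = ⌊(n : ℝ≥0) * X / B⌋₊ := by rw [hk, min_eq_right hlt.le]
      have h2 : (n : ℝ≥0) * X / B < (k : ℝ≥0) + 1 := by
        rw [hk']; exact Nat.lt_floor_add_one _
      rw [div_lt_iff₀ hB'] at h2
      have h3 : X ≤ ((k : ℝ≥0) + 1) * B / n := by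
        rw [le_div_iff₀ hn, mul_comm X]
        exact h2.le
      calc X ≤ ((k : ℝ≥0) + 1) * B / n := h3
        _ = (k : ℝ≥0) * (B / n) + B / n := by ring
    · -- `k = n`: `X ≤ B = n · (B/n)`
      have hk' : k = (n : ℕ) := by rw [hk, min_eq_left hle]
      rw [hk']
      calc X ≤ B := hXB
        _ = ((n : ℕ) : ℝ≥0) * (B / n) := by
            rw [Nat.cast_inj.mpr rfl, show (((n : ℕ) : ℝ≥0)) = (n : ℝ≥0) from rfl,
              mul_div_cancel₀ B hn.ne']
        _ ≤ ((n : ℕ) : ℝ≥0) * (B / n) + B / n := le_self_add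

/-- Counting: `Σ_{v < n} [v < k] · t = k · t` for `k ≤ n`. [folklore] -/
private theorem sum_ite_lt {t : ℝ≥0} {n k : ℕ} (hk : k ≤ n) :
    (∑ v ∈ Finset.range n, if v < k then t else 0) = (k : ℝ≥0) * t := by
  rw [Finset.sum_ite, Finset.sum_const_zero, add_zero, Finset.sum_const, nsmul_eq_mul]
  congr 2
  have : (Finset.range n).filter (fun v => v < k) = Finset.range k := by
    ext v
    simp only [Finset.mem_filter, Finset.mem_range]
    omega
  rw [this, Finset.card_range]

/-- **Coordinates for `M^rlf`, weak form.** For a weakly perf-factorial `M` whose `M^pf_𝔮` are monoprime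
there is an injective homomorphism `cR : M^rlf → ∏_𝔮 ℝ_{≥0}` such that: `cR` is an order embedding for
`∣` with downward closed image; `M^pf → M^rlf` composed with `cR` is an order embedding for `∣` on
`M^pf` ((d_ord)); every `x ∈ M^rlf` has a support gauge `b ∈ M^pf`; and every `x ≤ b` (`b ∈ M^pf`) is
approximable as `a ≤ x ≤ a · b^{1/n}` by `a ∈ M^pf`, for every `n ≥ 1` ((d_res): relative
simple-function approximants).  The printed "for every `a ∈ P^rlf` there exists `a' ∈ P^pf` such that
`a' ≥ a`" (p. 75) is NOT asserted — it fails for the weak notion. [cite: MochizukiEtTh2009, Lem 3.5 p.75] -/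
theorem exists_coordinates (hP : IsPerfFactorialWeak M)
    (hb : ∀ 𝔮 : Primes (Perfection M), IsMonoprime (PfAt M 𝔮)) :
    ∃ cR : hP.Rlf →* (Primes (Perfection M) → Multiplicative ℝ≥0),
      Injective cR ∧
      (∀ x y : hP.Rlf, x ∣ y ↔ cR x ≤ cR y) ∧
      (∀ (s : Primes (Perfection M) → Multiplicative ℝ≥0) (y : hP.Rlf), s ≤ cR y → s ∈ Set.range cR) ∧
      (∀ a b : Perfection M, a ∣ b ↔ cR (hP.toRealification a) ≤ cR (hP.toRealification b)) ∧
      (∀ x : hP.Rlf, ∃ b : Perfection M,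
        ∀ 𝔮, cR x 𝔮 ≠ 1 → cR (hP.toRealification b) 𝔮 ≠ 1) ∧
      (∀ (x : hP.Rlf) (b : Perfection M), x ∣ hP.toRealification b → ∀ n : ℕ+,
        ∃ a : Perfection M, cR (hP.toRealification a) ≤ cR x ∧
          cR x ≤ cR (hP.toRealification (a * isPerfect_perfection.root n b))) := by
  classical
  let f : ∀ 𝔮 : Primes (Perfection M), RlfAt M 𝔮 ≃* Multiplicative ℝ≥0 :=
    fun 𝔮 => Classical.choice (nonempty_coord (hb 𝔮))
  let Fe : RlfFactor M ≃* (Primes (Perfection M) → Multiplicative ℝ≥0) := MulEquiv.piCongrRight f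
  let cR : hP.Rlf →* (Primes (Perfection M) → Multiplicative ℝ≥0) :=
    Fe.toMonoidHom.comp hP.realification.subtype
  have hc : ∀ (x : hP.Rlf) (𝔮 : Primes (Perfection M)), cR x 𝔮 = f 𝔮 (x.1 𝔮) := fun _ _ => rfl
  have hcA : ∀ (a : Perfection M) (𝔮 : Primes (Perfection M)),
      cR (hP.toRealification a) 𝔮 = f 𝔮 (factorMap M a 𝔮) := fun _ _ => rfl
  have hsharp : ∀ 𝔮 : Primes (Perfection M), IsSharp (RlfAt M 𝔮) := fun 𝔮 => isSharp_realification _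
  -- (2) order reflection on `M^pf` via (d_ord)
  have hordA : ∀ a b : Perfection M, a ∣ b ↔ cR (hP.toRealification a) ≤ cR (hP.toRealification b) := by
    intro a b
    refine ⟨fun h => (pi_mnnreal_dvd_iff_le _ _).mp (map_dvd _ (map_dvd _ h)), fun h => ?_⟩
    obtain ⟨xa, hxa⟩ := hP.factorMap_mem_range a
    obtain ⟨xb, hxb⟩ := hP.factorMap_mem_range b
    have hd : ∀ 𝔮 : Primes (Perfection M), xa 𝔮 ∣ xb 𝔮 := by
      intro 𝔮
      apply dvd_of_coord_le (f 𝔮) (hb 𝔮)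
      have h𝔮 := h 𝔮
      rw [hcA, hcA, ← hxa, ← hxb, pfFactorToRlfFactor_apply, pfFactorToRlfFactor_apply] at h𝔮
      exact h𝔮
    choose d hd using hd
    apply hP.dvd_of_factorMap_mul_eq (x := d)
    rw [← hxa, ← hxb, ← map_mul]
    congr 1
    funext 𝔮
    rw [Pi.mul_apply]
    exact (hd 𝔮).symm
  refine ⟨cR, ?_, fun x y => ⟨fun h => ?_, fun h => ?_⟩, fun s y hs => ?_, hordA, fun x => ?_,
    fun x b hxb n => ?_⟩
  · -- injective
    exact Fe.injective.comp Subtype.val_injective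
  · -- `x ∣ y ⇒ cR x ≤ cR y`
    exact (pi_mnnreal_dvd_iff_le _ _).mp (map_dvd cR h)
  · -- `cR x ≤ cR y ⇒ x ∣ y`: the coordinatewise quotient has admissible support
    obtain ⟨by_, hby⟩ := y.2
    have ht : ∀ 𝔮 : Primes (Perfection M), ∃ t : RlfAt M 𝔮, y.1 𝔮 = x.1 𝔮 * t := by
      intro 𝔮
      obtain ⟨t, ht⟩ := le_iff_exists_mul.mp (h 𝔮)
      refine ⟨(f 𝔮).symm t, (f 𝔮).injective ?_⟩
      rw [map_mul, MulEquiv.apply_symm_apply, ← hc, ← hc]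
      exact ht
    choose t ht using ht
    have htmem : (fun 𝔮 => t 𝔮) ∈ hP.realification := by
      refine ⟨by_, fun 𝔮 h𝔮 => hby fun hy => h𝔮 ?_⟩
      have hy' := ht 𝔮
      rw [hy] at hy'
      exact (hsharp 𝔮).1 _ (IsUnit.of_mul_eq_one _ (by rw [mul_comm]; exact hy'.symm))
    refine ⟨⟨fun 𝔮 => t 𝔮, htmem⟩, Subtype.ext (funext fun 𝔮 => ?_)⟩
    exact ht 𝔮
  · -- downward closed
    obtain ⟨by_, hby⟩ := y.2
    let s' : RlfFactor M := fun 𝔮 => (f 𝔮).symm (s 𝔮)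
    have hs'mem : s' ∈ hP.realification := by
      refine ⟨by_, fun 𝔮 h𝔮 => hby fun hy => h𝔮 ?_⟩
      have hs𝔮 : s 𝔮 ≤ 1 := by
        have := hs 𝔮
        rwa [hc, hy, map_one] at this
      show (f 𝔮).symm (s 𝔮) = 1
      rw [le_antisymm hs𝔮 one_le, map_one]
    refine ⟨⟨s', hs'mem⟩, funext fun 𝔮 => ?_⟩
    rw [hc]
    exact (f 𝔮).apply_symm_apply (s 𝔮)
  · -- support gauge
    obtain ⟨b, hbx⟩ := x.2
    refine ⟨b, fun 𝔮 h𝔮 hb𝔮 => h𝔮 ?_⟩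
    rw [hcA, EmbeddingLike.map_eq_one_iff] at hb𝔮
    rw [hc, EmbeddingLike.map_eq_one_iff]
    by_contra hx
    exact hbx hx hb𝔮
  · -- relative approximation `a ≤ x ≤ a · b^{1/n}` below an upper bound `b ∈ M^pf`, via (d_res)
    -- additive coordinates
    set X : Primes (Perfection M) → ℝ≥0 := fun 𝔮 => Multiplicative.toAdd (cR x 𝔮)
    set B : Primes (Perfection M) → ℝ≥0 :=
      fun 𝔮 => Multiplicative.toAdd (cR (hP.toRealification b) 𝔮)
    have hXB : ∀ 𝔮, X 𝔮 ≤ B 𝔮 := fun 𝔮 => (pi_mnnreal_dvd_iff_le _ _).mp (map_dvd cR hxb) 𝔮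
    -- the number of steps at `𝔮` and the nested sets `S_v`
    let k : Primes (Perfection M) → ℕ := fun 𝔮 => min (n : ℕ) ⌊(n : ℝ≥0) * X 𝔮 / B 𝔮⌋₊
    have hkn : ∀ 𝔮, k 𝔮 ≤ n := fun 𝔮 => min_le_left _ _
    let S : ℕ → Set (Primes (Perfection M)) := fun v => {𝔮 | v < k 𝔮}
    -- the restrictions `b|_{S_v} ∈ M^pf` ((d_res)) and their `n`-th roots
    choose c hcv using fun v : ℕ => hP.exists_factorMap_eq_restrict b (S v)
    let r : ℕ → Perfection M := fun v => isPerfect_perfection.root n (c v)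
    have hr : ∀ v, r v ^ (n : ℕ) = c v := fun v => IsPerfect.root_pow _ n _
    -- coordinates of `c v`, `r v`, `b^{1/n}`
    have hcC : ∀ v 𝔮, Multiplicative.toAdd (cR (hP.toRealification (c v)) 𝔮) =
        if 𝔮 ∈ S v then B 𝔮 else 0 := by
      intro v 𝔮
      have hv := congr_fun (hcv v) 𝔮
      rw [hcA, hv]
      by_cases h𝔮 : 𝔮 ∈ S v
      · rw [if_pos h𝔮, if_pos h𝔮]
        rfl
      · rw [if_neg h𝔮, if_neg h𝔮, map_one, toAdd_one]
    have hroot : ∀ (y z : Perfection M), y ^ (n : ℕ) = z → ∀ 𝔮,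
        Multiplicative.toAdd (cR (hP.toRealification y) 𝔮) =
          Multiplicative.toAdd (cR (hP.toRealification z) 𝔮) / n := by
      intro y z hyz 𝔮
      have hn : (n : ℝ≥0) ≠ 0 := by exact_mod_cast n.pos.ne'
      rw [eq_div_iff hn, ← hyz, map_pow, map_pow, Pi.pow_apply, toAdd_pow, nsmul_eq_mul, mul_comm]
    have hcR : ∀ v 𝔮, Multiplicative.toAdd (cR (hP.toRealification (r v)) 𝔮) =
        if v < k 𝔮 then B 𝔮 / n else 0 := by
      intro v 𝔮
      rw [hroot (r v) (c v) (hr v), hcC]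
      by_cases h𝔮 : v < k 𝔮
      · rw [if_pos (show 𝔮 ∈ S v from h𝔮), if_pos h𝔮]
      · rw [if_neg (show 𝔮 ∉ S v from h𝔮), if_neg h𝔮, zero_div]
    -- the approximant
    let a : Perfection M := ∏ v ∈ Finset.range n, r v
    have haA : ∀ 𝔮, Multiplicative.toAdd (cR (hP.toRealification a) 𝔮) = (k 𝔮 : ℝ≥0) * (B 𝔮 / n) := by
      intro 𝔮
      rw [map_prod, map_prod, Finset.prod_apply, toAdd_prod]
      simp_rw [hcR]
      exact sum_ite_lt (hkn 𝔮)
    have hbn : ∀ 𝔮, Multiplicative.toAdd (cR (hP.toRealification (isPerfect_perfection.root n b)) 𝔮) =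
        B 𝔮 / n := fun 𝔮 => by rw [hroot _ b (IsPerfect.root_pow _ n b)]
    refine ⟨a, fun 𝔮 => ?_, fun 𝔮 => ?_⟩
    · show Multiplicative.toAdd (cR (hP.toRealification a) 𝔮) ≤ X 𝔮
      rw [haA]
      exact (floor_rel_step (hXB 𝔮) n).1
    · show X 𝔮 ≤ Multiplicative.toAdd (cR (hP.toRealification (a * isPerfect_perfection.root n b)) 𝔮)
      rw [map_mul, map_mul, Pi.mul_apply, toAdd_mul, haA, hbn]
      exact (floor_rel_step (hXB 𝔮) n).2

/-- `M^rlf` (weak) is sharp and its order `∣` is antisymmetric (it embeds in `∏ ℝ_{≥0}`).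
[cite: MochizukiEtTh2009, Lem 3.5 p.75] -/
theorem dvd_antisymm (hP : IsPerfFactorialWeak M) (hb : ∀ 𝔮 : Primes (Perfection M), IsMonoprime (PfAt M 𝔮))
    {x y : hP.Rlf} (h₁ : x ∣ y) (h₂ : y ∣ x) : x = y := by
  obtain ⟨cR, hinj, hord, -⟩ := exists_coordinates hP hb
  exact hinj (le_antisymm ((hord x y).mp h₁) ((hord y x).mp h₂))

/-! ### Coordinate-free corollaries used by the extension theorem -/

/-- **Order embedding `M^pf ↪ M^rlf`** (weak form, via (d_ord)). For `a, b ∈ M^pf`: `a ≤ b` in `M^rlf`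
iff `a ≤ b` in `M^pf`. [cite: MochizukiEtTh2009, Lem 3.5 p.76] -/
theorem toRealification_dvd_iff (hP : IsPerfFactorialWeak M)
    (hb : ∀ 𝔮 : Primes (Perfection M), IsMonoprime (PfAt M 𝔮)) (a b : Perfection M) :
    hP.toRealification a ∣ hP.toRealification b ↔ a ∣ b := by
  obtain ⟨cR, -, hord, -, hordA, -⟩ := exists_coordinates hP hb
  rw [hord, hordA]

/-- In `∏ ℝ_{≥0}` a product is trivial at a coordinate only if each factor is. [cite: MochizukiFrdI2008, §0 p.10] -/
private theorem mnnreal_eq_one_of_mul_eq_one {a b : Multiplicative ℝ≥0} (h : a * b = 1) : b = 1 :=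
  le_antisymm ((le_mul_self (b := a)).trans h.le) one_le

/-- **Gauges and roots, weak form.** Under COFINALITY of `M^pf` in `M^rlf` (`hcof`, the printed "for
every `a ∈ P^rlf`, there exists an `a' ∈ P^pf` such that `a' ≥ a`", p. 75 — an hypothesis here), every
`x ∈ M^rlf` admits a gauge `b ∈ M^pf` with `x ≤ b` such that for every `n ≥ 1` there is `a ∈ M^pf` with
`a ≤ x ≤ a · b^{1/n}`. [cite: MochizukiEtTh2009, Lem 3.5 p.75] -/
theorem exists_gauge (hP : IsPerfFactorialWeak M)
    (hb : ∀ 𝔮 : Primes (Perfection M), IsMonoprime (PfAt M 𝔮))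
    (hcof : ∀ x : hP.Rlf, ∃ b : Perfection M, x ∣ hP.toRealification b) (x : hP.Rlf) :
    ∃ b : Perfection M, x ∣ hP.toRealification b ∧
      ∀ n : ℕ+, ∃ a : Perfection M, hP.toRealification a ∣ x ∧
        x ∣ hP.toRealification (a * isPerfect_perfection.root n b) := by
  obtain ⟨cR, -, hord, -, -, -, happrox⟩ := exists_coordinates hP hb
  obtain ⟨b, hxb⟩ := hcof x
  refine ⟨b, hxb, fun n => ?_⟩
  obtain ⟨a, ha1, ha2⟩ := happrox x b hxb n
  exact ⟨a, (hord _ _).mpr ha1, (hord _ _).mpr ha2⟩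

/-- A nonnegative real below `b + C/n` for every `n ≥ 1` is `≤ b`. [cite: MochizukiFrdI2008, §0 p.10] -/
private theorem nnreal_le_of_forall_le_add_div {a b C : ℝ≥0} (h : ∀ n : ℕ+, a ≤ b + C / n) : a ≤ b := by
  by_contra hab
  replace hab : b < a := not_le.mp hab
  obtain ⟨δ, hδ, hδ'⟩ : ∃ δ : ℝ≥0, 0 < δ ∧ b + δ < a := by
    refine ⟨(a - b) / 2, by simpa using hab, ?_⟩
    have : b + (a - b) = a := add_tsub_cancel_of_le hab.le
    have h2 : (a - b) / 2 < a - b := NNReal.half_lt_self (ne_of_gt (tsub_pos_of_lt hab))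
    calc b + (a - b) / 2 < b + (a - b) := by gcongr
      _ = a := this
  obtain ⟨n, hn⟩ := exists_nat_gt (C / δ)
  have hnpos : 0 < n := by
    rcases Nat.eq_zero_or_pos n with h0 | h0
    · rw [h0, Nat.cast_zero] at hn; exact absurd hn (not_lt.mpr zero_le)
    · exact h0
  have key := h ⟨n, hnpos⟩
  have hCn : C / (n : ℝ≥0) < δ := by
    rw [div_lt_iff₀ (by exact_mod_cast hnpos)]
    calc C = (C / δ) * δ := (div_mul_cancel₀ C hδ.ne').symm
      _ < n * δ := by gcongr
      _ = δ * n := mul_comm _ _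
  have : a < a := calc
    a ≤ b + C / (n : ℝ≥0) := key
    _ < b + δ := by gcongr
    _ < a := hδ'
  exact lt_irrefl _ this

/-- **Archimedean property of `M^rlf`** (weak form). If `x ≤ y · E_n` for `n`-th roots `E_n` of a fixed
`C ∈ M^rlf` and every `n ≥ 1`, then `x ≤ y`. [cite: MochizukiEtTh2009, Lem 3.5 p.76] -/
theorem dvd_of_forall_root (hP : IsPerfFactorialWeak M)
    (hb : ∀ 𝔮 : Primes (Perfection M), IsMonoprime (PfAt M 𝔮)) {x y C : hP.Rlf}
    (h : ∀ n : ℕ+, ∃ E : hP.Rlf, E ^ (n : ℕ) = C ∧ x ∣ y * E) : x ∣ y := by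
  obtain ⟨cR, -, hord, -⟩ := exists_coordinates hP hb
  refine (hord x y).mpr fun i => ?_
  show Multiplicative.toAdd (cR x i) ≤ Multiplicative.toAdd (cR y i)
  apply nnreal_le_of_forall_le_add_div (C := Multiplicative.toAdd (cR C i))
  intro n
  obtain ⟨E, hE, hxE⟩ := h n
  have h1 : Multiplicative.toAdd (cR x i) ≤ Multiplicative.toAdd (cR y i) + Multiplicative.toAdd (cR E i) := by
    have := (hord _ _).mp hxE i
    rwa [map_mul, Pi.mul_apply] at this
  have h2 : (n : ℝ≥0) * Multiplicative.toAdd (cR E i) = Multiplicative.toAdd (cR C i) := by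
    rw [← hE, map_pow, Pi.pow_apply, toAdd_pow, nsmul_eq_mul]
  have hn : (n : ℝ≥0) ≠ 0 := by exact_mod_cast n.pos.ne'
  rw [← h2, mul_div_cancel_left₀ _ hn]
  exact h1

/-! ### Cofinality is automatic for perf-factorial `M` (printed Def. 2.4 (i)(d)) -/

/-- For a perf-factorial `M` (printed (d)), `M^pf` is cofinal in `M^rlf`: "for every `a ∈ P^rlf`, there
exists an `a' ∈ P^pf` such that `a' ≥ a`" (p. 75) — the hypothesis `hcof` of the weak engine, discharged.
[cite: MochizukiEtTh2009, Lem 3.5 p.75] -/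
theorem rlf_cofinal_of_isPerfFactorial (h : IsPerfFactorial M) (x : h.weak.Rlf) :
    ∃ b : Perfection M, x ∣ h.weak.toRealification b := by
  obtain ⟨b, hb, -⟩ := RlfCoord.exists_gauge h (PerfectionPrimes.isMonoprime_pfAt h) x
  exact ⟨b, hb⟩

end RlfCoordWeak

end Literature.AnabelianGeometry.EtaleTheta
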